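import Literature.NumberTheory.EllipticCurves.BSDAnalyticRank
import Literature.NumberTheory.EllipticCurves.BSDGoldfeldEulerProduct
import Literature.NumberTheory.LFunctions.PartialEulerProductsProofs
import HarnessLib

/-!
# bsd.S35 (Goldfeld's theorem) from modularity: the assembly

Sibling proof file of `Literature.NumberTheory.EllipticCurves.BSDAnalyticRank` for the named
fact `Literature.NumberTheory.EllipticCurves.analyticRank_eq_of_isEquivalent_prod` (**bsd.S35**; D. Goldfeld, *Sur les produits
partiels eulériens attachés aux courbes elliptiques*, C. R. Acad. Sci. Paris 294 (1982) 471–474;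
K. Conrad, *Partial Euler products on the critical line*, Canad. J. Math. **57** (2005), Thm. 1.1
and Cor. 5.7): *if `∏_{p ≤ x} N_p/p ∼ C (log x)^r` (`C > 0`, `r ∈ ℕ`), then `L(E,s) ≠ 0` on
`Re s > 1` and `ord_{s=1} L(E,s) = r`.*

Architecture of the printed proof (Conrad, proof of Cor. 5.7, p. 281: "Apply Corollary 4.11
and Theorem 5.3 to `L(s) = L(E, s + 1/2)`", and "Our use of the last part of Theorem 5.3 tacitly
appeals to the elliptic modularity theorem to get holomorphy of `L(E, s)` at `s = 1`"):

1. `L(E, s + 1/2)` is a normalized Euler product of degree `≤ 2` over `ℚ` with data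
   `α_{p,j} = β_{p,j}/√p`, `L_p(T) = (1 - β_{p,1}T)(1 - β_{p,2}T)` Mathlib's local polynomial
   (`WeierstrassCurve.exists_eulerDatum`, `…BSDGoldfeldEulerProduct`: Hasse's bound makes it
   normalized, the Euler product converges to `W.LSeries` on `Re s > 3/2`);
2. the BSD hypothesis `∏_{p ≤ x} N_p/p ∼ C (log x)^r` is Conrad's `Prod(E,x)⁻¹ ∼ C (log x)^r`
   up to the finitely many bad primes, where `L_p(1/p)` and `N_p/p` may differ (Mathlib's type of
   points of the singular reduction omits the singular point); these change the partial products
   by an eventually constant positive factor `κ`, so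
   `∑_{p ≤ x} ∑_j -log(1 - α_{p,j}/√p) = -log ∏_{p ≤ x} L_p(1/p) = -r log log x - log (κC) + o(1)`
   (this is Conrad's Lemma 3.2 in the real, positive case), in particular Conrad's hypothesis in
   `O(1)`-form holds (`isBoundedUnder_logPartialProduct_of_isEquivalent`);
3. the `O(1)`-form of Conrad's Thm. 5.3 (`Literature.NumberTheory.LFunctions.PartialEuler.ne_zero_and_analyticOrderAt_eq_of_isBoundedUnder`,
   `Literature.NumberTheory.LFunctions.PartialEulerProductsProofs`, Part II) applied to
   `G(s) = L(E, s + 1/2)` — holomorphic because `L(E, s)` is assumed entire (modularity) — gives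
   `L(E, s) ≠ 0` for `Re s > 1` and `ord_{s=1} L(E, s) = r`.

Conrad's route through Cor. 4.11 (second-moment hypothesis, Shimura's theorem, Thm. 4.9) serves
only the constant `C = B/(√2 e^{rγ})` of Cor. 5.7, which bsd.S35 does not state; it is not
formalized.

Results (no new definitions):
* `Literature.NumberTheory.EllipticCurves.analyticRank_eq_of_isEquivalent_prod_of_hasEntireLFunction`: the fact for every `W` whose
  `L`-function has an entire continuation;
* `Literature.NumberTheory.EllipticCurves.analyticRank_eq_of_isEquivalent_prod_of_hasEntireLFunction_rat`: the fact for every `W`,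
  from the named fact `WeierstrassCurve.hasEntireLFunction_rat` (modularity: Wiles 1995,
  Breuil–Conrad–Diamond–Taylor 2001; in the tree reduced to `Literature.NumberTheory.EllipticCurves.ModularForms.exists_isNewformOf`
  by `WeierstrassCurve.hasEntireLFunction_rat_of_exists_isNewformOf`).

So bsd.S35 is reduced, sorry-free, to the modularity theorem, exactly as in print;
`analyticRank_eq_of_isEquivalent_prod_holds` itself waits for a discharge of
`hasEntireLFunction_rat`.

## References

* D. Goldfeld, C. R. Acad. Sci. Paris Sér. I 294 (1982) 471–474. [cite: Goldfeld1982]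
* K. Conrad, *Partial Euler products on the critical line*, Canad. J. Math. 57 (2005) 267–297,
  Thm. 1.1, Lemma 3.2, Thm. 5.3, Cor. 5.7 and the remark following its proof (p. 281).
  [cite: Conrad2005PartialEuler]
-/

noncomputable section

open scoped Topology
open Filter Finset Complex Asymptotics WeierstrassCurve Literature.NumberTheory.LFunctions.PartialEuler

namespace Literature.NumberTheory.EllipticCurves

/-! ### Step 2: the BSD asymptotic gives Conrad's hypothesis in `O(1)`-form -/

/-- **From `∏_{p ≤ x} N_p/p ∼ C (log x)^r` to `∑_{p ≤ x} c_p(1/2) = -r log log x + O(1)`**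
(Conrad 2005, (1.1)–(1.2) and Lemma 3.2, real positive case, with the bad primes absorbed into
the constant). Let `α` be a datum and `t : ℕ → ℝ` with `t_p > 0` and
`∑_j -log(1 - α_{p,j} p^{-1/2}) = -log t_p` at every prime, and `t_p = N_p/p` for all primes
outside a finite set `S`, where `N_p > 0`. If `∏_{p ≤ x} N_p/p ∼ C (log x)^r` with `C > 0`, then
`‖∑_{p ≤ x} ∑_j -log(1 - α_{p,j} p^{-1/2}) + r log log x‖` is bounded as `x → ∞` (indeed it
converges to `|log (κ C)|`, `κ = ∏_{p ∈ S} t_p p/N_p`).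
[cite: Conrad2005PartialEuler, Lemma 3.2 and (1.1)–(1.2)] -/
theorem isBoundedUnder_logPartialProduct_of_isEquivalent {d : ℕ} {α : ℕ → Fin d → ℂ}
    {t N : ℕ → ℝ} (ht : ∀ p : ℕ, p.Prime → 0 < t p ∧ logEulerFactor α (1 / 2) p = -((Real.log (t p) : ℝ) : ℂ))
    (hN : ∀ p : ℕ, p.Prime → 0 < N p) {S : Finset ℕ} (hS : ∀ p : ℕ, p.Prime → p ∉ S → t p = N p / p)
    {C : ℝ} (hC : 0 < C) {r : ℕ}
    (h : (fun x : ℝ => ∏ p ∈ Nat.primesLE ⌊x⌋₊, N p / p) ~[atTop] fun x => C * Real.log x ^ r) :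
    IsBoundedUnder (· ≤ ·) atTop
      fun x : ℝ => ‖logPartialProduct α (1 / 2) x + r * Real.log (Real.log x)‖ := by
  -- the correction factor over the bad primes
  set S' : Finset ℕ := S.filter Nat.Prime with hS'
  set κ : ℝ := ∏ p ∈ S', t p / (N p / p) with hκ
  have hn : ∀ p : ℕ, p.Prime → 0 < N p / p := fun p hp =>
    div_pos (hN p hp) (by exact_mod_cast hp.pos)
  have hκpos : 0 < κ := Finset.prod_pos fun p hp => div_pos (ht p (Finset.mem_filter.mp hp).2).1
    (hn p (Finset.mem_filter.mp hp).2)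
  -- eventually `S' ⊆ primesLE ⌊x⌋₊`
  have hev : ∀ᶠ x : ℝ in atTop, S' ⊆ Nat.primesLE ⌊x⌋₊ := by
    filter_upwards [eventually_ge_atTop ((S.sup id : ℕ) : ℝ)] with x hx p hp
    have hp' := Finset.mem_filter.mp hp
    refine Nat.mem_primesLE.mpr ⟨?_, hp'.2⟩
    refine Nat.le_floor ?_
    have : (p : ℝ) ≤ ((S.sup id : ℕ) : ℝ) := by exact_mod_cast Finset.le_sup (f := id) hp'.1
    linarith
  -- `∏ t_p = κ ∏ N_p/p` eventually
  have hQ : ∀ᶠ x : ℝ in atTop, ∏ p ∈ Nat.primesLE ⌊x⌋₊, t p = κ * ∏ p ∈ Nat.primesLE ⌊x⌋₊, N p / p := by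
    filter_upwards [hev] with x hx
    have h1 : ∏ p ∈ Nat.primesLE ⌊x⌋₊, t p =
        ∏ p ∈ Nat.primesLE ⌊x⌋₊, (N p / p * (t p / (N p / p))) := by
      refine Finset.prod_congr rfl fun p hp => ?_
      rw [mul_div_cancel₀ _ (hn p (Nat.prime_of_mem_primesLE hp)).ne']
    rw [h1, Finset.prod_mul_distrib, mul_comm, hκ]
    congr 1
    symm
    refine Finset.prod_subset hx fun p hp hpS => ?_
    have hp' := Nat.prime_of_mem_primesLE hp
    have hpS0 : p ∉ S := fun h0 => hpS (Finset.mem_filter.mpr ⟨h0, hp'⟩)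
    rw [hS p hp' hpS0, div_self (hn p hp').ne']
  -- hence `∏ t_p ∼ κ C (log x)^r`, and the ratio tends to `1`
  have hQequiv : (fun x : ℝ => ∏ p ∈ Nat.primesLE ⌊x⌋₊, t p) ~[atTop]
      fun x => κ * (C * Real.log x ^ r) := by
    refine ((IsEquivalent.refl (u := fun _ : ℝ => κ)).mul h).congr_left ?_
    filter_upwards [hQ] with x hx
    simp only [Pi.mul_apply]
    exact hx.symm
  have hz : ∀ᶠ x : ℝ in atTop, κ * (C * Real.log x ^ r) ≠ 0 := by
    filter_upwards [eventually_gt_atTop 1] with x hx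
    have : 0 < Real.log x := Real.log_pos hx
    positivity
  have hratio := (isEquivalent_iff_tendsto_one hz).mp hQequiv
  -- take logarithms
  have hlog : Tendsto (fun x : ℝ => Real.log ((∏ p ∈ Nat.primesLE ⌊x⌋₊, t p) / (κ * (C * Real.log x ^ r))))
      atTop (𝓝 0) := by
    have := ((Real.continuousAt_log one_ne_zero).tendsto.comp hratio)
    rw [Real.log_one] at this
    exact this
  have hlog' : Tendsto (fun x : ℝ => ∑ p ∈ Nat.primesLE ⌊x⌋₊, Real.log (t p) -
      (Real.log (κ * C) + r * Real.log (Real.log x))) atTop (𝓝 0) := by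
    refine hlog.congr' ?_
    filter_upwards [eventually_gt_atTop 1] with x hx
    have hlx : 0 < Real.log x := Real.log_pos hx
    have hQpos : 0 < ∏ p ∈ Nat.primesLE ⌊x⌋₊, t p :=
      Finset.prod_pos fun p hp => (ht p (Nat.prime_of_mem_primesLE hp)).1
    rw [Real.log_div hQpos.ne' (by positivity), Real.log_prod (s := Nat.primesLE ⌊x⌋₊) (f := t)
      (fun p hp => (ht p (Nat.prime_of_mem_primesLE hp)).1.ne'), Real.log_mul (by positivity) (by positivity),
      Real.log_mul hκpos.ne' hC.ne', Real.log_mul hC.ne' (pow_ne_zero _ hlx.ne'), Real.log_pow]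
    ring
  -- the double sum at `1/2` is `-∑ log t_p`
  have hD : ∀ x : ℝ, logPartialProduct α (1 / 2) x =
      -((∑ p ∈ Nat.primesLE ⌊x⌋₊, Real.log (t p) : ℝ) : ℂ) := by
    intro x
    rw [logPartialProduct, ofReal_sum, ← Finset.sum_neg_distrib]
    exact Finset.sum_congr rfl fun p hp => (ht p (Nat.prime_of_mem_primesLE hp)).2
  -- conclude: the function tends to `-log(κC)`, hence is bounded
  have hT : Tendsto (fun x : ℝ => logPartialProduct α (1 / 2) x + r * Real.log (Real.log x)) atTop
      (𝓝 (-((Real.log (κ * C) : ℝ) : ℂ))) := by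
    have h1 := (continuous_ofReal.tendsto _).comp hlog'
    have h2 : Tendsto (fun x : ℝ => -(((∑ p ∈ Nat.primesLE ⌊x⌋₊, Real.log (t p) -
        (Real.log (κ * C) + r * Real.log (Real.log x)) : ℝ) : ℂ)) - (Real.log (κ * C) : ℂ)) atTop
        (𝓝 (-((0 : ℝ) : ℂ) - (Real.log (κ * C) : ℂ))) := (h1.neg).sub tendsto_const_nhds
    simp only [ofReal_zero, neg_zero, zero_sub] at h2
    refine h2.congr fun x => ?_
    rw [hD x]
    push_cast
    ring
  exact hT.norm.isBoundedUnder_le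

/-! ### Step 3: Goldfeld's theorem from an entire continuation of `L(E, s)` -/

/-- **bsd.S35 for a curve whose `L`-function is entire** (Goldfeld 1982; Conrad 2005, Thm. 1.1 /
Cor. 5.7, whose proof "tacitly appeals to the elliptic modularity theorem to get holomorphy of
`L(E,s)` at `s = 1`"). Let `E/ℚ` be an elliptic curve with globally minimal equation `W` such that
`L(E, s)` has an entire continuation (`W.HasEntireLFunction`; then `W.entireLFunction` is that
continuation and `W.analyticRank` is its order at `1`). If `∏_{p ≤ x} N_p/p ∼ C (log x)^r`
(`C > 0`, `r ∈ ℕ`), then `W.analyticRank = r` and `L(E, s) ≠ 0` for `Re s > 1`. Proof: steps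
1–3 of the module docstring. [cite: Conrad2005PartialEuler, Thm. 1.1 and Cor. 5.7]
[cite: Goldfeld1982, Théorème (p. 471)] -/
theorem analyticRank_eq_of_isEquivalent_prod_of_hasEntireLFunction (W : WeierstrassCurve ℚ)
    [W.IsElliptic] [W.IsGloballyMinimal] (hW : W.HasEntireLFunction) :
    analyticRank_eq_of_isEquivalent_prod W := by
  intro r C hC h
  -- Step 1: the normalized Euler product
  obtain ⟨α, hα, hEuler, t, ht, S, hS⟩ := W.exists_eulerDatum
  -- Step 2: Conrad's hypothesis
  have h' : (fun x : ℝ => ∏ p ∈ Nat.primesLE ⌊x⌋₊, (W.reductionPointCount p : ℝ) / p) ~[atTop]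
      fun x => C * Real.log x ^ r := by
    refine h.congr_left (Eventually.of_forall fun x => ?_)
    refine Finset.prod_congr ?_ fun _ _ => rfl
    ext p
    simp [Nat.mem_primesLE]
  have hH := isBoundedUnder_logPartialProduct_of_isEquivalent (N := fun p => (W.reductionPointCount p : ℝ))
    ht (fun p hp => by
      haveI : NeZero p := ⟨hp.ne_zero⟩
      exact_mod_cast W.reductionPointCount_pos p) hS hC h'
  -- Step 3: the order theorem for `G(s) = L(E, s + 1/2)`
  set L := W.entireLFunction with hL
  have hLd : Differentiable ℂ L := W.differentiable_entireLFunction hW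
  have hGd : DifferentiableOn ℂ (fun s : ℂ => L (s + 1 / 2)) {s : ℂ | 1 / 2 < s.re} :=
    (hLd.comp (differentiable_id.add_const _)).differentiableOn
  have hGlim : ∀ s : ℂ, 1 < s.re →
      Tendsto (fun x : ℝ => partialProduct α s x) atTop (𝓝 (L (s + 1 / 2))) := by
    intro s hs
    rw [hL, W.entireLFunction_eq_LSeries hW (by simp; linarith)]
    exact hEuler s hs
  obtain ⟨hne, hord⟩ := ne_zero_and_analyticOrderAt_eq_of_isBoundedUnder hα hH hGd hGlim
  refine ⟨?_, fun s hs => ?_⟩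
  · -- the analytic rank
    have hg : AnalyticAt ℂ (fun s : ℂ => s + 1 / 2) (1 / 2) := analyticAt_id.add analyticAt_const
    have hGa : AnalyticAt ℂ (fun s : ℂ => L (s + 1 / 2)) (1 / 2) :=
      (hLd.analyticAt _).comp hg
    obtain ⟨m, hm, hmr⟩ := hord hGa
    have hshift : analyticOrderAt (fun s : ℂ => L (s + 1 / 2)) (1 / 2) = analyticOrderAt L 1 := by
      have hderiv : deriv (fun s : ℂ => s + 1 / 2) (1 / 2) ≠ 0 := by
        rw [deriv_add_const, deriv_id'']
        exact one_ne_zero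
      have := analyticOrderAt_comp_of_deriv_ne_zero (f := L) hg hderiv
      rw [show (1 / 2 : ℂ) + 1 / 2 = 1 by norm_num] at this
      exact this
    rw [hshift] at hm
    have hmr' : m = r := by exact_mod_cast hmr
    change analyticOrderNatAt L 1 = r
    rw [analyticOrderNatAt, hm, ENat.toNat_coe, hmr']
  · -- nonvanishing on `Re s > 1`
    have := hne (s - 1 / 2) (by simp; linarith)
    simpa using this

/-- **bsd.S35 from modularity** (Goldfeld 1982; Conrad 2005, Thm. 1.1 / Cor. 5.7): the named fact
`Literature.analyticRank_eq_of_isEquivalent_prod W` for every elliptic `W/ℚ` in globally minimal form,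
from the named fact `WeierstrassCurve.hasEntireLFunction_rat` (entire continuation of `L(E, s)`
for elliptic curves over `ℚ`: Wiles 1995, Breuil–Conrad–Diamond–Taylor 2001; reduced in the tree
to `Literature.NumberTheory.EllipticCurves.ModularForms.exists_isNewformOf` by
`WeierstrassCurve.hasEntireLFunction_rat_of_exists_isNewformOf`). This is the full printed proof
of Goldfeld's theorem; the discharge `analyticRank_eq_of_isEquivalent_prod_holds` needs exactly
the modularity input. [cite: Conrad2005PartialEuler, Cor. 5.7 and the remark after its proof (p. 281)]
[cite: Goldfeld1982, Théorème (p. 471)] -/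
theorem analyticRank_eq_of_isEquivalent_prod_of_hasEntireLFunction_rat
    (hmod : WeierstrassCurve.hasEntireLFunction_rat) (W : WeierstrassCurve ℚ) [W.IsElliptic]
    [W.IsGloballyMinimal] : analyticRank_eq_of_isEquivalent_prod W :=
  analyticRank_eq_of_isEquivalent_prod_of_hasEntireLFunction W (hmod W)

end Literature.NumberTheory.EllipticCurves

end
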